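import Summits.QuantumFields.BalabanUV.Beta.RemainderConstTwoShapes
import Literature.MathematicalPhysics.QuantumFieldTheory.Balaban1983to89.BetaDerivClause
import Mathlib.Analysis.Complex.Liouville

/-!
# RemainderCouplingHolomorphy — print's «(or analytic)» alternative for the β-functions ([I] p. 263 tl.25–26, p. 264 tl.25–27,
# p. 266 tl.33–37) AS A TYPED ROUTE to binder (D4): a j- and history-uniform HOLOMORPHIC extension of g_k ↦ β_{k+1}(g₀,…,g_k)
# to discs of one radius ρ with one sup bound M gives the derivative clause with C = M∕ρ (Cauchy's estimate), hence (AF-1),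
# hence the JUNCTION shape of (D4) — R-264's exit reached from a STRONGER hypothesis («R-264 (hol)», labelled R-266 here; the
# citation-fit desk folds it into R-264: one junction input, two print-side suppliers — W-fit2-g16-6)

Cell `pub-balaban`, β-function sub-cell, BINDER row D4 «RemainderConst leaves for Bałaban's split» (`HOME/BINDER-OWNERS.md`; this
file by the row OWNER lineage `b2b-balaban-beta-an4`, generation 61), β-FLOW TEAM duty (1); FREEZE (0) honoured (def-free module in
the lineage's own `Beta/…Remainder…` series; no leaf, no interface).  LOCATED ITEM: today's coordinator ask `HOME/beta/CMP109-FIDELITY.md`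
(v1.2) grades the p. 264 clause «smooth … (or analytic), uniformly bounded on this interval together with all derivatives» STATED
inside Theorem 3 and NEVER ARGUED; print's only sentence on the MECHANISM is p. 266 tl.33–37 «Another possibility is to take
g_k∕γ_kε₁ instead of ε₁ … It has the advantage that the functions 𝐄^{(j)}, β_j are analytic functions of the effective coupling
constants» (cell GAPS G-b12-2).  This file types WHAT THAT ALTERNATIVE WOULD HAVE TO DELIVER for (D4): not analyticity alone,
but analyticity on a complex neighbourhood of [0, γ₀] of a radius ρ INDEPENDENT of the scale and the history, with ONE sup bound
M there — then Cauchy's estimate is the unprinted «one line».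

HONEST FRAMING (BETA-SPEC §0.2, verbatim and binding). *"Discharging BetaPertH makes Bałaban's UV stability UNCONDITIONAL — a
real constructive-QFT result; it is NOT the continuum limit and NOT the Clay problem."*  THIS MODULE DISCHARGES NOTHING: it is
Cauchy's estimate (Mathlib `Complex.norm_deriv_le_of_forall_mem_sphere_norm_le`) applied to the tree's typed shapes `FlowStep.HBeta`,
`B12Beta.OneLoopSplit`, `BetaDerivClause.LastVarDerivBound`, `Beta.RemainderChain.RemainderConst`; the holomorphic extension is a
HYPOTHESIS (nothing of Bałaban's is asserted, constructed or instantiated); row D4 class UNCHANGED (critical-path width 0; instance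
0∕1; D4 DISCHARGE NO DATE).  NOT BetaPertH, NOT continuum, NOT Clay.  HONEST DEPENDENCY: continuum YM on T⁴ ⇐ BetaPertH ∧ nine
spine estimates (0/9 proved); BetaPertH ⇐ (D1) ∧ (D4) ∧ CAP+tail; G-an2-4 gates asym, D1 and NE2/3/4.

WHAT IS PROVED ([folklore]; 0 sorry; 0 `def`).  The hypothesis, spelled inline: «∃ ρ > 0, M ≥ 0 such that for every scale k and
every history p ∈ ]0,γ₀]^{k+1} there is F : ℂ → ℂ, complex-differentiable on the open ρ-neighbourhood of the real segment [0, γ₀],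
with ‖F z‖ ≤ M there, and F(g) = β_{k+1}(g₀,…,g_{k−1}, g) for real g ∈ [0, γ₀]».
* §1 `hasDerivAt_re_of_holo` (the real restriction t ↦ Re F(t) has derivative Re F′(t)); `norm_deriv_le_of_holo_nhd` (‖F′(g)‖ ≤ M∕ρ at
  every g ∈ [0, γ₀], Cauchy on the disc of radius ρ about g, which lies in the neighbourhood).
* §2 `lastVarDerivBound_of_holo` : the hypothesis ⇒ `BetaDerivClause.LastVarDerivBound β (M∕ρ) γ₀`; hence `af1_of_holo` ((AF-1) with
  C = M∕ρ, via `lastVarLipschitz_of_derivBound` → `atZero_of_lastVarLipschitz` → `af1_of_atZero`) and `junction_of_holo` (the JUNCTION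
  shape of (D4), via `RemainderConstTwoShapes.junction_of_af1`), `remainderConst_of_holo` (`RemainderConst S γ ((M∕ρ)·γ)`, γ ≤ γ₀).
READING (sense (α)): R-266 = «R-264 (hol)» is a SUFFICIENT route — R-264's own exit (`LastVarDerivBound` → (AF-1) → JUNCTION)
reached from a strictly stronger hypothesis — with the same missing INSTANCE; what it adds to print's word «analytic» is
the pair (ρ, M) uniform in k and in the history — exactly the letters p. 264 does not print («uniformly bounded» without a constant)
and [II] pp. 21–22 do not argue.  Class UNCHANGED.
-/

noncomputable section

open Metric Set Complex

namespace Summit.QuantumFields.BalabanUV.Beta.RemainderCouplingHolomorphy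

open Literature.MathematicalPhysics.QuantumFieldTheory.Balaban1983to89
open Literature.MathematicalPhysics.QuantumFieldTheory.Balaban1983to89.FlowStep (HBeta)
open Literature.MathematicalPhysics.QuantumFieldTheory.Balaban1983to89.Beta.RemainderChain (RemainderConst)
open Literature.MathematicalPhysics.QuantumFieldTheory.Balaban1983to89.BetaDerivClause
  (LastVarDerivBound lastVarLipschitz_of_derivBound atZero_of_lastVarLipschitz af1_of_atZero)
open Summit.QuantumFields.BalabanUV.Beta.EriceRemainderEnclosureHistoryJunction (histBox_mono)
open Summit.QuantumFields.BalabanUV.Beta.RemainderConstTwoShapes (junction_of_af1)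

variable {β : HBeta}

/-! ## §1 Cauchy's estimate on a uniform neighbourhood of the coupling interval -/

/-- The real restriction `t ↦ Re F(t)` of a function complex-differentiable at the real point `t` has derivative `Re F′(t)`.
[folklore] -/
theorem hasDerivAt_re_of_holo {F : ℂ → ℂ} {t : ℝ} (hF : DifferentiableAt ℂ F (t : ℂ)) :
    HasDerivAt (fun s : ℝ => (F (s : ℂ)).re) (deriv F (t : ℂ)).re t := by
  exact hF.hasDerivAt.real_of_complex

/-- **Cauchy on a uniform neighbourhood.**  If `F` is complex-differentiable on the open `ρ`-neighbourhood
`{z | ∃ s ∈ [0, γ₀], dist z s < ρ}` of the segment `[0, γ₀]` and `‖F z‖ ≤ M` there, then `‖F′(g)‖ ≤ M ∕ ρ'` at every real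
`g ∈ [0, γ₀]` for every `0 < ρ' < ρ` (the closed disc of radius `ρ'` about `g` lies in the neighbourhood). [folklore] -/
theorem norm_deriv_le_of_holo_nhd {F : ℂ → ℂ} {γ₀ ρ ρ' M : ℝ} (hρ' : 0 < ρ') (hρ'ρ : ρ' < ρ)
    (hdiff : DifferentiableOn ℂ F {z : ℂ | ∃ s : ℝ, s ∈ Icc (0 : ℝ) γ₀ ∧ dist z (s : ℂ) < ρ})
    (hM : ∀ z : ℂ, (∃ s : ℝ, s ∈ Icc (0 : ℝ) γ₀ ∧ dist z (s : ℂ) < ρ) → ‖F z‖ ≤ M)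
    {g : ℝ} (hg : g ∈ Icc (0 : ℝ) γ₀) : ‖deriv F (g : ℂ)‖ ≤ M / ρ' := by
  have hsub : closedBall (g : ℂ) ρ' ⊆ {z : ℂ | ∃ s : ℝ, s ∈ Icc (0 : ℝ) γ₀ ∧ dist z (s : ℂ) < ρ} :=
    fun z hz => ⟨g, hg, lt_of_le_of_lt (mem_closedBall.mp hz) hρ'ρ⟩
  have hopen : IsOpen {z : ℂ | ∃ s : ℝ, s ∈ Icc (0 : ℝ) γ₀ ∧ dist z (s : ℂ) < ρ} := by
    have : {z : ℂ | ∃ s : ℝ, s ∈ Icc (0 : ℝ) γ₀ ∧ dist z (s : ℂ) < ρ} = ⋃ s ∈ Icc (0 : ℝ) γ₀, ball (s : ℂ) ρ := by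
      ext z; simp [mem_ball]
    rw [this]; exact isOpen_biUnion fun _ _ => isOpen_ball
  have hdc : DiffContOnCl ℂ F (ball (g : ℂ) ρ') := by
    refine ⟨hdiff.mono (ball_subset_closedBall.trans hsub), ?_⟩
    rw [closure_ball (g : ℂ) hρ'.ne']
    exact (hdiff.mono hsub).continuousOn
  exact Complex.norm_deriv_le_of_forall_mem_sphere_norm_le hρ' hdc
    fun z hz => hM z (hsub (sphere_subset_closedBall hz))

/-! ## §2 The route R-266: uniform coupling-holomorphy ⇒ the derivative clause ⇒ (AF-1) ⇒ the junction shape of (D4) -/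

/-- **UNIFORM COUPLING-HOLOMORPHY ⇒ `LastVarDerivBound β (M∕ρ') γ₀`** for every `0 < ρ' < ρ`: if for every scale `k` and history
`p ∈ ]0,γ₀]^{k+1}` the last-variable section `g ↦ β_{k+1}(g₀,…,g_{k−1}, g)` is the real restriction of a function `F` holomorphic and
bounded by `M` on the `ρ`-neighbourhood of `[0, γ₀]` — ONE `ρ`, ONE `M` — then `|∂β_{k+1}∕∂g_k| ≤ M∕ρ'` on `[0, γ₀]`, uniformly.
The pair (ρ, M) is what [I]'s «(or analytic) … uniformly bounded» leaves unlettered.  SIZE NOTE (co-owner d4-p2's remark W-d4p2-g21-3):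
`F` extends β = β⁰ + β¹ itself, so `M ≥ |β⁰_{k+1}|` (≈ 2b at the drift's b) and the constant `C = M∕ρ′ ≳ 2b∕ρ′` is NOT b-free — harmless
for the junction (which asks small γ only: γ₁ ≈ ρ′∕4), but no reader should hope for a b-free C from this route; an extension of β¹ alone
would give one. [cite: Balaban1987RG1, §1 p.264 and §2 p.266 — shapes only, nothing asserted] -/
theorem lastVarDerivBound_of_holo {γ₀ ρ ρ' M : ℝ} (hρ' : 0 < ρ') (hρ'ρ : ρ' < ρ)
    (hHol : ∀ (k : ℕ) (p : Fin (k + 1) → ℝ), p ∈ B12Beta.HistBox γ₀ k → ∃ F : ℂ → ℂ,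
      DifferentiableOn ℂ F {z : ℂ | ∃ s : ℝ, s ∈ Icc (0 : ℝ) γ₀ ∧ dist z (s : ℂ) < ρ} ∧
      (∀ z : ℂ, (∃ s : ℝ, s ∈ Icc (0 : ℝ) γ₀ ∧ dist z (s : ℂ) < ρ) → ‖F z‖ ≤ M) ∧
      ∀ g : ℝ, g ∈ Icc (0 : ℝ) γ₀ → F (g : ℂ) = (β k (Function.update p (Fin.last k) g) : ℂ)) :
    LastVarDerivBound β (M / ρ') γ₀ := by
  intro k p hp
  obtain ⟨F, hdiff, hM, hF⟩ := hHol k p hp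
  refine ⟨fun g => (deriv F (g : ℂ)).re, fun g hg => ?_, fun g hg => ?_⟩
  · have hmem : (g : ℂ) ∈ {z : ℂ | ∃ s : ℝ, s ∈ Icc (0 : ℝ) γ₀ ∧ dist z (s : ℂ) < ρ} :=
      ⟨g, hg, by simpa using (hρ'.trans hρ'ρ)⟩
    have hopen : IsOpen {z : ℂ | ∃ s : ℝ, s ∈ Icc (0 : ℝ) γ₀ ∧ dist z (s : ℂ) < ρ} := by
      have : {z : ℂ | ∃ s : ℝ, s ∈ Icc (0 : ℝ) γ₀ ∧ dist z (s : ℂ) < ρ} = ⋃ s ∈ Icc (0 : ℝ) γ₀, ball (s : ℂ) ρ := by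
        ext z; simp [mem_ball]
      rw [this]; exact isOpen_biUnion fun _ _ => isOpen_ball
    have hder := hasDerivAt_re_of_holo (hdiff.differentiableAt (hopen.mem_nhds hmem))
    -- the real function agrees with β on [0, γ₀]
    have heq : ∀ s ∈ Icc (0 : ℝ) γ₀, (F (s : ℂ)).re = β k (Function.update p (Fin.last k) s) := fun s hs => by
      rw [hF s hs, Complex.ofReal_re]
    exact (hder.hasDerivWithinAt.congr (fun s hs => (heq s hs).symm) (heq g hg).symm)
  · exact (abs_re_le_norm _).trans (norm_deriv_le_of_holo_nhd hρ' hρ'ρ hdiff hM hg)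

/-- **R-266 ⇒ (AF-1)** with constant `M∕ρ'`: `|β¹_{k+1}(g₀,…,g_k)| ≤ (M∕ρ')·g_k` on ]0,γ₀]^{k+1}, for the printed split (β¹ = 0 at g_k = 0).
[cite: Balaban1987RG1, (2.12)–(2.14) p.268 and §1 p.264 — shapes only, nothing asserted] -/
theorem af1_of_holo (S : B12Beta.OneLoopSplit β) {γ₀ ρ ρ' M : ℝ} (hρ' : 0 < ρ') (hρ'ρ : ρ' < ρ)
    (hHol : ∀ (k : ℕ) (p : Fin (k + 1) → ℝ), p ∈ B12Beta.HistBox γ₀ k → ∃ F : ℂ → ℂ,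
      DifferentiableOn ℂ F {z : ℂ | ∃ s : ℝ, s ∈ Icc (0 : ℝ) γ₀ ∧ dist z (s : ℂ) < ρ} ∧
      (∀ z : ℂ, (∃ s : ℝ, s ∈ Icc (0 : ℝ) γ₀ ∧ dist z (s : ℂ) < ρ) → ‖F z‖ ≤ M) ∧
      ∀ g : ℝ, g ∈ Icc (0 : ℝ) γ₀ → F (g : ℂ) = (β k (Function.update p (Fin.last k) g) : ℂ)) :
    ∀ (k : ℕ) (p : Fin (k + 1) → ℝ), p ∈ B12Beta.HistBox γ₀ k → |S.β1 k p| ≤ M / ρ' * p (Fin.last k) :=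
  af1_of_atZero S (atZero_of_lastVarLipschitz (lastVarLipschitz_of_derivBound (lastVarDerivBound_of_holo hρ' hρ'ρ hHol)))

/-- **R-266 ⇒ `RemainderConst S γ ((M∕ρ')·γ)` on every box `γ ≤ γ₀`** — the r = Cγ → 0 shape. [folklore] -/
theorem remainderConst_of_holo (S : B12Beta.OneLoopSplit β) {γ₀ ρ ρ' M : ℝ} (hρ' : 0 < ρ') (hρ'ρ : ρ' < ρ) (hM : 0 ≤ M)
    (hHol : ∀ (k : ℕ) (p : Fin (k + 1) → ℝ), p ∈ B12Beta.HistBox γ₀ k → ∃ F : ℂ → ℂ,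
      DifferentiableOn ℂ F {z : ℂ | ∃ s : ℝ, s ∈ Icc (0 : ℝ) γ₀ ∧ dist z (s : ℂ) < ρ} ∧
      (∀ z : ℂ, (∃ s : ℝ, s ∈ Icc (0 : ℝ) γ₀ ∧ dist z (s : ℂ) < ρ) → ‖F z‖ ≤ M) ∧
      ∀ g : ℝ, g ∈ Icc (0 : ℝ) γ₀ → F (g : ℂ) = (β k (Function.update p (Fin.last k) g) : ℂ))
    {γ : ℝ} (hγ : γ ≤ γ₀) : RemainderConst S γ (M / ρ' * γ) := by
  have hC : 0 ≤ M / ρ' := div_nonneg hM hρ'.le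
  intro k p hp
  exact (af1_of_holo S hρ' hρ'ρ hHol k p (histBox_mono hγ hp)).trans (mul_le_mul_of_nonneg_left (hp (Fin.last k)).2 hC)

/-- **R-266 ⇒ THE JUNCTION SHAPE of (D4)** (hence CONSUMED(b) at every b, `RemainderConstTwoShapes.junction_iff_forall_consumed`).
[cite: Balaban1987RG1, Thm 2 p.259 (first sentence) and §1 p.264 — shapes only, nothing asserted] -/
theorem junction_of_holo (S : B12Beta.OneLoopSplit β) {γ₀ ρ ρ' M : ℝ} (hγ₀ : 0 < γ₀) (hρ' : 0 < ρ') (hρ'ρ : ρ' < ρ)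
    (hM : 0 ≤ M)
    (hHol : ∀ (k : ℕ) (p : Fin (k + 1) → ℝ), p ∈ B12Beta.HistBox γ₀ k → ∃ F : ℂ → ℂ,
      DifferentiableOn ℂ F {z : ℂ | ∃ s : ℝ, s ∈ Icc (0 : ℝ) γ₀ ∧ dist z (s : ℂ) < ρ} ∧
      (∀ z : ℂ, (∃ s : ℝ, s ∈ Icc (0 : ℝ) γ₀ ∧ dist z (s : ℂ) < ρ) → ‖F z‖ ≤ M) ∧
      ∀ g : ℝ, g ∈ Icc (0 : ℝ) γ₀ → F (g : ℂ) = (β k (Function.update p (Fin.last k) g) : ℂ)) :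
    ∀ b : ℝ, 0 < b → ∃ γ₁ : ℝ, 0 < γ₁ ∧ ∀ γ : ℝ, 0 < γ → γ ≤ γ₁ →
      ∃ r : ℝ, 0 ≤ r ∧ r < b ∧ RemainderConst S γ r :=
  junction_of_af1 S (div_nonneg hM hρ'.le) hγ₀ (af1_of_holo S hρ' hρ'ρ hHol)

end Summit.QuantumFields.BalabanUV.Beta.RemainderCouplingHolomorphy

end
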